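import Literature.MathematicalPhysics.QuantumFieldTheory.Balaban1983to89.T4AveragingDisintegration
import HarnessLib

/-!
# Crux `FluctuationComparisonRegPrIntL` (stmt-QuantumFields-20520, rung R3), PATH-B organ, v18 (H-currency): BRICK TS —
# THE GOOD∕BAD (TAIL) SPLIT OF A WEIGHTED FIBRE INTEGRAL: `|∫ F·w| ≤ A·∫ w + Mb·∫_{Goodᶜ} w` (abstract, DEFINITION-FREE)

Cell `ym3-torus` (YM ladder rung R3 = continuum `SU(2)` Yang–Mills on the three-torus — a RUNG: NOT d = 4, NOT infinite volume, NOT a mass gap, NOT Clay).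
LEAD-20520 width seat `ym-ust-20520-w3` (gen 25); V18 LIN KNIT SPEC §6.1∕§6.2 (commit 447767752830): under fix (c″) «output pair clause modulo an additive floor» every
channel of ✓2b's knit is split into a GOOD part (fibre points whose displacement grid stays in the seed window — bilinear letters) and a BAD part (zone II∕III, edge sliver —
crude bound × floor-small weight mass = the additive floor `ϖ`).  This file is that split as ONE generic lemma; `--kind proof --supports stmt-QuantumFields-20520 --as helper`,
count-neutral, no registry ∕ binder ∕ `Lines/` edit, default heartbeats, `autoImplicit false`.

WHAT.  ★`abs_integral_mul_weight_le_good_add_bad`: on any measure space, for a weight `w ≥ 0` (integrable), a function `F` with `|F| ≤ Mb` everywhere (no measurability needed: the bound is on `∫|F·w|`)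
and `|F| ≤ A` on a measurable set `Good` (`0 ≤ A`): `|∫ F·w| ≤ A·∫ w + Mb·∫_{Goodᶜ} w`; ★`abs_integral_mul_weight_le_good_add_bad_of_normalised` (`∫ w = 1`):
`|∫ F·w| ≤ A + Mb·∫_{Goodᶜ} w`.  In the knit: `F := ΔΔ_V (h_{Ts} ∘ Φ(·, z))` (≤ `k_c·szc m·szc m′` on GOOD by ✓2a∕2a-O, ≤ `4·sup|h|` everywhere), `w := ŵ₁₁`,
`∫_{Goodᶜ} ŵ₁₁ ≤ ηin Ts` (FIBRE-LAW-H (τ)) ⟹ pull-back channel `≤ k_c·szc m·szc m′ + 4·Hsup·ηin` = letters + floor.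

HONEST FRAMING: measure-theoretic bookkeeping; nothing of Bałaban's; LINᵘ-H ∕ JVARᵘ-H ∕ O1ᵘ-H v2(∕v2.1) ∕ S1aᴴ ∕ 26243 ∕ S2α′ ∕ S2β OPEN; crux 20520 `FluctuationComparisonRegPrIntL` ∕
`YM3TorusSU2` NOT proved; no summit ∕ sub-problem statement is proved; rung R3 = SU(2) YM₃ on T³ at fixed lattice data — NOT d = 4, NOT infinite volume, NOT a mass gap, NOT
Clay; the Yang–Mills mass gap is NOT proved.  [folklore]
-/

set_option autoImplicit false

noncomputable section

namespace Summit.QuantumFields.YangMills.Theorems.OrganTangentFibreMeanTailSplit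

open MeasureTheory Set

variable {Ω : Type*} [MeasurableSpace Ω]

/-- ★ **GOOD∕BAD SPLIT**: `|∫ F·w| ≤ A·∫ w + Mb·∫_{Goodᶜ} w` for a weight `w ≥ 0`, `|F| ≤ A` on `Good`, `|F| ≤ Mb` everywhere. [folklore] -/
theorem abs_integral_mul_weight_le_good_add_bad (P : Measure Ω) (F w : Ω → ℝ) (Good : Set Ω) (hGood : MeasurableSet Good) (A Mb : ℝ)
    (hA : 0 ≤ A) (hFb : ∀ ξ, |F ξ| ≤ Mb) (hFg : ∀ ξ ∈ Good, |F ξ| ≤ A)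
    (hw : Integrable w P) (hwnn : ∀ ξ, 0 ≤ w ξ) :
    |∫ ξ, F ξ * w ξ ∂P| ≤ A * (∫ ξ, w ξ ∂P) + Mb * (∫ ξ in Goodᶜ, w ξ ∂P) := by
  -- pointwise domination `|F ξ * w ξ| ≤ A * w ξ + Mb * (Goodᶜ.indicator w ξ)`
  have hdom : ∀ ξ, |F ξ * w ξ| ≤ A * w ξ + Mb * Goodᶜ.indicator w ξ := by
    intro ξ
    have hMb : 0 ≤ Mb := (abs_nonneg _).trans (hFb ξ)
    rw [abs_mul, abs_of_nonneg (hwnn ξ)]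
    by_cases hξ : ξ ∈ Good
    · have h1 : |F ξ| * w ξ ≤ A * w ξ := mul_le_mul_of_nonneg_right (hFg ξ hξ) (hwnn ξ)
      have h2 : 0 ≤ Mb * Goodᶜ.indicator w ξ := mul_nonneg hMb (Set.indicator_nonneg (fun _ _ => hwnn _) _)
      linarith
    · have hξc : ξ ∈ Goodᶜ := hξ
      rw [Set.indicator_of_mem hξc]
      have h1 : |F ξ| * w ξ ≤ Mb * w ξ := mul_le_mul_of_nonneg_right (hFb ξ) (hwnn ξ)
      have h2 : 0 ≤ A * w ξ := mul_nonneg hA (hwnn ξ)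
      linarith
  have hind : Integrable (Goodᶜ.indicator w) P := hw.indicator hGood.compl
  calc |∫ ξ, F ξ * w ξ ∂P|
      ≤ ∫ ξ, |F ξ * w ξ| ∂P := by
        simpa only [Real.norm_eq_abs] using norm_integral_le_integral_norm (fun ξ => F ξ * w ξ)
    _ ≤ ∫ ξ, (A * w ξ + Mb * Goodᶜ.indicator w ξ) ∂P := by
        refine integral_mono_of_nonneg (Filter.Eventually.of_forall (fun ξ => abs_nonneg _))
          ((hw.const_mul A).add (hind.const_mul Mb)) (Filter.Eventually.of_forall hdom)
    _ = A * (∫ ξ, w ξ ∂P) + Mb * (∫ ξ in Goodᶜ, w ξ ∂P) := by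
        rw [integral_add (hw.const_mul A) (hind.const_mul Mb), integral_const_mul, integral_const_mul,
          integral_indicator hGood.compl]

/-- ★ The NORMALISED edition (`∫ w = 1`): `|∫ F·w| ≤ A + Mb·∫_{Goodᶜ} w`. [folklore] -/
theorem abs_integral_mul_weight_le_good_add_bad_of_normalised (P : Measure Ω) (F w : Ω → ℝ) (Good : Set Ω) (hGood : MeasurableSet Good) (A Mb : ℝ)
    (hA : 0 ≤ A) (hFb : ∀ ξ, |F ξ| ≤ Mb) (hFg : ∀ ξ ∈ Good, |F ξ| ≤ A)
    (hw : Integrable w P) (hwnn : ∀ ξ, 0 ≤ w ξ) (hn : ∫ ξ, w ξ ∂P = 1) :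
    |∫ ξ, F ξ * w ξ ∂P| ≤ A + Mb * (∫ ξ in Goodᶜ, w ξ ∂P) := by
  have h := abs_integral_mul_weight_le_good_add_bad P F w Good hGood A Mb hA hFb hFg hw hwnn
  rw [hn, mul_one] at h
  exact h

end Summit.QuantumFields.YangMills.Theorems.OrganTangentFibreMeanTailSplit

end
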